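import Summits.CriticalPhenomena.CardyFormulaZ2.Theorems.CardySusyWardParafermionFamiliesToSLESixAnchorMoment
import Summits.CriticalPhenomena.CardyFormulaZ2.Theorems.CardySusyWardParafermionFamiliesToSLESixMomentIdentity
import Summits.CriticalPhenomena.CardyFormulaZ2.Theorems.CardySusyWardParafermionFamiliesToSLESixTotalSmall
import Summits.CriticalPhenomena.CardyFormulaZ2.Theorems.ParafermionFamiliesToSLESix.Negative.PrecompactIffVanishing

/-!
# `ParafermionFamiliesToSLESix` and bulk non-degeneracy of the `q = 1` parafermion, MODULO the uniform inner
# envelope and Ikhlef–Ponsaing's strip law (line `strip-anchored-vertex-normalisation`, skeleton r4, closing form)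

Crux `CardySusyWard.ParafermionFamiliesToSLESix` (stmt-CriticalPhenomena-10814).  The reshaped line (lead c2) proves the
crux AS TYPED — `WeakHolomorphy → ParafermionPrecompact → (SLE₆ along every family)` — by contradicting its second
hypothesis, which as typed is the vanishing normalisation `δ^{-1/3} F_δ → 0` on compacts along EVERY family
(`parafermionPrecompact_iff_vanishing`), through the GLOBAL boundary first-moment identity ("discrete Cauchy–Pompeiu"):

* `stub_momentIdentity` (`…MomentIdentity.lean`): `2cos(π/12) · Σ_{S_max} F_δ = Σ_wall G − 2(1−i) · Σ_wall conj(ẑ) coeff G`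
  along every family (conj-weighted Green identity `…WeightedGreen.lean` + half-CR on every random vertex
  `…HalfCRLayer.lean` + the vertex–corner bridge);
* `stub_anchorMoment_of_IP` (`…AnchorMoment.lean`): for the concrete family `anchorData` of the diagonal square the
  right-hand side has norm `≥ c δ^{-5/3}` under Ikhlef–Ponsaing's strip law (deterministic touch phases on all four
  sides, positivity of `Re + Im`, S5's `touchProb_lower`);
* `stub_totalSmall_of_UIE` (`…TotalSmall.lean`): under the uniform inner envelope and vertex vanishing the left-hand
  side is `o(δ^{-5/3})`.

Hence (this file, sorry-free): `UniformInnerEnvelope → IkhlefPonsaingFirstPassage → ¬ParafermionPrecompact`, i.e.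
`→ ParafermionBulkNondegenerate` (Duminil-Copin–Smirnov 2012, Conj. 8.7's non-degeneracy for bond percolation on `ℤ²`,
`Literature.Probability.LatticeModels.ParafermionBulkNondegenerate`, `[status: open]`), and `→ ParafermionFamiliesToSLESix`.
The two hypotheses are the registered open stubs of the skeleton (`stub_uniformInnerEnvelope`, shared by name with crux
stmt-CriticalPhenomena-11387, and the Literature fact `IkhlefPonsaingFirstPassage`); these CONDITIONAL theorems are the
line's closing form until they land.
-/

noncomputable section

namespace Summit.CriticalPhenomena.CardyFormulaZ2.Theorems.ParafermionFamiliesToSLESix.StripAnchored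

open MeasureTheory Filter Set Metric
open scoped Topology
open Literature.Probability.LatticeModels (DiscreteDobrushin ParafermionBulkNondegenerate)
open Literature.Probability.RandomPlanarGeometry (DobrushinDomain)
open Summit.CriticalPhenomena.CardyFormulaZ2.Theses.CardySusyWard
open Summit.CriticalPhenomena.CardyFormulaZ2.Theorems.ParafermionPrecompact.Negative (IsFamily
  parafermionPrecompact_iff_vanishing parafermionPrecompact_iff_not_bulkNondegenerate)
open Summit.CriticalPhenomena.CardyFormulaZ2.Cruxes.EdgePrecompact.QkzStripBoundaryArm (UniformInnerEnvelope)
open S5 (anchorDomain)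

/-- **The typed hypothesis `ParafermionPrecompact` contradicts the uniform inner envelope and the strip law.**
Along the concrete anchor family the moment identity expresses `2cos(π/12) · totalVertexSum` as the boundary first moment
(norm `≥ c δ^{-5/3}` by `stub_anchorMoment_of_IP`), while vertex vanishing (the typed hypothesis, via
`parafermionPrecompact_iff_vanishing`) and the envelope make it `≤ (c/2) δ^{-5/3}` eventually (`stub_totalSmall_of_UIE`);
at a common small `δ > 0` this is absurd. [folklore] -/
theorem false_of_envelope_of_IP_of_parafermionPrecompact (hUB : UniformInnerEnvelope)
    (hIP : Literature.Probability.Percolation.IkhlefPonsaingFirstPassage) (hP : ParafermionPrecompact) : False := by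
  obtain ⟨Λ, hΛ, c, hc, hbig⟩ := stub_anchorMoment_of_IP hIP
  have hV : VertexVanishes anchorDomain Λ := fun K hK hKD =>
    (parafermionPrecompact_iff_vanishing.1 hP) anchorDomain Λ hΛ K hK hKD
  set A : ℝ := 2 * Real.cos (Real.pi / 12) with hA
  have hA0 : 0 < A := by
    have : 0 < Real.cos (Real.pi / 12) :=
      Real.cos_pos_of_mem_Ioo ⟨by linarith [Real.pi_pos], by linarith [Real.pi_pos]⟩
    positivity
  have hη : 0 < c / (2 * A) := by positivity
  have hsmall := stub_totalSmall_of_UIE hUB Λ hΛ hV (c / (2 * A)) hη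
  obtain ⟨δ, ⟨⟨hid, hle⟩, hge⟩, hδpos⟩ :=
    (((stub_momentIdentity anchorDomain Λ hΛ).and hsmall).and hbig |>.and self_mem_nhdsWithin).exists
  have hδ0 : (0:ℝ) < δ := hδpos
  have hpow : (0:ℝ) < δ ^ (-(5:ℝ) / 3) := Real.rpow_pos_of_pos hδ0 _
  have key : c * δ ^ (-(5:ℝ) / 3) ≤ c / 2 * δ ^ (-(5:ℝ) / 3) := by
    calc c * δ ^ (-(5:ℝ) / 3) ≤ ‖wallPlainSum (Λ δ) δ - 2 * (1 - Complex.I) * momentSum (Λ δ) δ‖ := hge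
      _ = ‖((A : ℝ) : ℂ) * totalVertexSum (Λ δ) δ‖ := by rw [← hid]
      _ = A * ‖totalVertexSum (Λ δ) δ‖ := by rw [norm_mul, Complex.norm_real, Real.norm_of_nonneg hA0.le]
      _ ≤ A * (c / (2 * A) * δ ^ (-(5:ℝ) / 3)) := mul_le_mul_of_nonneg_left hle hA0.le
      _ = c / 2 * δ ^ (-(5:ℝ) / 3) := by field_simp
  have := le_of_mul_le_mul_right key hpow
  linarith

/-- **Bulk non-degeneracy of the spin-`1/3` parafermion of bond percolation on `ℤ²` (Duminil-Copin–Smirnov 2012,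
Conjecture 8.7's lower bound, `ParafermionBulkNondegenerate`) from the uniform inner envelope and Ikhlef–Ponsaing's
strip law** — the line's deliverable `H` in closing form. [cite: DuminilCopinSmirnov2012Lattice, Conjecture 8.7] -/
theorem bulkNondegenerate_of_envelope_of_IP : UniformInnerEnvelope → Literature.Probability.Percolation.IkhlefPonsaingFirstPassage → ParafermionBulkNondegenerate := by
  intro hUB hIP
  by_contra hH
  exact false_of_envelope_of_IP_of_parafermionPrecompact hUB hIP (parafermionPrecompact_iff_not_bulkNondegenerate.2 hH)

/-- **The crux `ParafermionFamiliesToSLESix` (stmt-CriticalPhenomena-10814) AS TYPED, modulo the uniform inner envelope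
and Ikhlef–Ponsaing's strip law**: its second hypothesis is contradictory under them, so the implication holds. [folklore] -/
theorem parafermionFamiliesToSLESix_of_envelope_of_IP : UniformInnerEnvelope → Literature.Probability.Percolation.IkhlefPonsaingFirstPassage → ParafermionFamiliesToSLESix :=
  fun hUB hIP _hW hP => (false_of_envelope_of_IP_of_parafermionPrecompact hUB hIP hP).elim

end Summit.CriticalPhenomena.CardyFormulaZ2.Theorems.ParafermionFamiliesToSLESix.StripAnchored

end
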